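import Literature.AlgebraicGeometry.Resolution.QuadraticTransformsStructure
import Literature.AlgebraicGeometry.Resolution.BlowupRingChartCoordinates
import HarnessLib

/-!
# Steer / CLAIM R kernel, file R3b: the chart of a quadratic transform — localisation, the chart map
# `Θ : S₀[𝔪₀/X] ↠ κ₀[T₁, T₂]`, and lifting a polynomial of degree `≤ δ` to `G = X^δ · w ∈ 𝔪₀^δ`

OURS (campaign res-hironaka, rung L ★L-G4, slot W4.1, crux `Steer` stmt-ResolutionOfSingularities-16345; res-L0-w41-plan-1
RULING 160d «CLAIM R kernel `exists_regularCurveGerm_of_nonRational`», RULING 171c/179e; res-L0-w41-idea-3 g9; consumer = (K-H)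
`LemmaI.GeomSupplyRegularCurve` of `L/res-L0-w41-idea-3/LemmaISketch.lean` v3.3; replaces the role of no printed item; NOT a statement of
the manuscript under review [claim: Hironaka2017, status: under-review]; AI review is weaker than expert review). Theses-free,
definition-free. For a quadratic transform `S₀ ≤ S₁` of local subrings of a field `L` with chart element `X`
(`Literature.AlgebraicGeometry.Resolution.IsQuadraticTransform`, Cutkosky §2.1) and `B = S₀[𝔪₀/X]`:

* `isLocalizationAtPrime_of_isQuadraticTransform` — `S₁` is the localisation of `B` at `𝔪₁ ∩ B` (tree
  `IsQuadraticTransform.eq_ofPrime` + Mathlib `LocalSubring.ofPrime`);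
* `exists_chartMap` — for `S₀` regular of embedding dimension `3` and a regular system of parameters `z` with `z 0 = X`: a ring
  surjection `Θ : B ↠ κ₀[T_j : j ≠ 0]` with kernel `XB`, `Θ(s) = s̄` on `S₀` and `Θ(z_j/X) = T_j` (tree `blowupRing_chartQuotient_X`,
  Stacks 0BIQ);
* `exists_lift_of_totalDegree_le` — for such a `Θ` (any index type) and `f` of total degree `≤ δ`: an element `w ∈ B` with `Θ w = f` and
  `G := X^δ w ∈ 𝔪₀^δ ⊆ S₀` (lift the coefficients and clear denominators monomial by monomial).
[cite: Cutkosky2014, §2.1] [cite: StacksProject, Tag 0BIQ] [folklore]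
-/

noncomputable section

-- single-problem summit: the doubled namespace component `ResolutionOfSingularities` is forced
set_option linter.dupNamespace false

namespace Summit.ResolutionOfSingularities.ResolutionOfSingularities.Theorems.SwitchingDichotomy.ClaimR

open IsLocalRing Literature.AlgebraicGeometry.Resolution MvPolynomial

variable {L : Type} [Field L]

/-! ## `S₁ = B_{𝔪₁ ∩ B}` -/

/-- **A quadratic transform is the localisation of its chart ring**: for `R[𝔪_R/X] = B ⊆ S₁` (any non-zero `X ∈ 𝔪₀` whose chart
contains `S₁`), `S₁` is `IsLocalization.AtPrime` of `B` at `𝔪₁ ∩ B` for the inclusion algebra. [cite: Cutkosky2014, §2.1] -/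
theorem isLocalizationAtPrime_of_isQuadraticTransform {S₀ S₁ : Subring L} [IsLocalRing S₀] [IsLocalRing S₁]
    (h : IsQuadraticTransform S₀ S₁) {X : S₀} (hX : X ∈ maximalIdeal S₀) (hX0 : X ≠ 0)
    (hB : blowupRing S₀ (X : L) ≤ S₁) :
    letI := (Subring.inclusion hB).toAlgebra
    IsLocalization.AtPrime S₁ ((maximalIdeal S₁).comap (Subring.inclusion hB)) := by
  letI := (Subring.inclusion hB).toAlgebra
  have hS := h.eq_ofPrime hX hX0 hB
  let e : (LocalSubring.ofPrime (blowupRing S₀ (X : L))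
      ((maximalIdeal S₁).comap (Subring.inclusion hB))).toSubring ≃ₐ[blowupRing S₀ (X : L)] S₁ :=
    AlgEquiv.ofRingEquiv (f := RingEquiv.subringCongr hS.symm) (fun b => Subtype.ext rfl)
  exact IsLocalization.isLocalization_of_algEquiv _ e

/-! ## The chart map `Θ` -/

/-- **The chart map** `Θ : S₀[𝔪₀/X] ↠ κ₀[T_j : j ≠ 0]` of the regular local subring `S₀ ⊆ L` of embedding dimension `3` with regular
system of parameters `z`, `X = z 0 ≠ 0`: surjective, kernel `X · S₀[𝔪₀/X]`, `Θ(s) = s̄` for `s ∈ S₀` and `Θ(z_j/X) = T_j`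
(the inverse of the tree's `blowupRing_chartQuotient_X`, composed with the quotient map). [cite: StacksProject, Tag 0BIQ] -/
theorem exists_chartMap (S₀ : Subring L) [IsRegularLocalRing S₀] {d : ℕ} (hd : (maximalIdeal S₀).spanFinrank = d)
    (z : Fin d → S₀) (hz : Ideal.span (Set.range z) = maximalIdeal S₀) (i : Fin d) (hzi : z i ≠ 0) :
    ∃ Θ : blowupRing S₀ ((z i : S₀) : L) →+* MvPolynomial {j : Fin d // j ≠ i} (ResidueField S₀),
      Function.Surjective Θ ∧
      RingHom.ker Θ = Ideal.span {(⟨((z i : S₀) : L), le_blowupRing S₀ _ (z i).2⟩ : blowupRing S₀ ((z i : S₀) : L))} ∧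
      (∀ s : S₀, Θ (Subring.inclusion (le_blowupRing S₀ ((z i : S₀) : L)) s) = C (residue S₀ s)) ∧
      (∀ (j : {j : Fin d // j ≠ i}) (h : ((z j.1 : S₀) : L) / ((z i : S₀) : L) ∈ blowupRing S₀ ((z i : S₀) : L)),
        Θ ⟨_, h⟩ = X j) := by
  obtain ⟨ψ, hψ, hψC, hψX⟩ := blowupRing_chartQuotient_X S₀ hd z hz i hzi
  let θ := (RingEquiv.ofBijective ψ hψ).symm
  refine ⟨θ.toRingHom.comp (Ideal.Quotient.mk _), θ.surjective.comp Ideal.Quotient.mk_surjective, ?_, ?_, ?_⟩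
  · ext b
    rw [RingHom.mem_ker, RingHom.comp_apply, RingEquiv.toRingHom_eq_coe, RingHom.coe_coe,
      EmbeddingLike.map_eq_zero_iff, Ideal.Quotient.eq_zero_iff_mem]
  · intro s
    change θ (Ideal.Quotient.mk _ _) = _
    rw [RingEquiv.symm_apply_eq]
    exact (hψC s).symm
  · intro j h
    change θ (Ideal.Quotient.mk _ _) = _
    rw [RingEquiv.symm_apply_eq]
    exact (hψX j h).symm

/-! ## Lifting a polynomial of degree `≤ δ` -/

/-- **Clearing denominators.** If `Θ : S₀[𝔪₀/X] → κ₀[T_j : j ∈ σ]` is a ring map with `Θ(s) = s̄` on `S₀` and `Θ(y_j/X) = T_j` for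
elements `y_j ∈ 𝔪₀`, then every `f` of total degree `≤ δ` lifts to `w = Σ c̃_m ∏ (y_j/X)^{m_j} ∈ S₀[𝔪₀/X]` with `Θ w = f`, and
`G := X^δ · w = Σ c̃_m (∏ y_j^{m_j}) X^{δ − |m|}` lies in `𝔪₀^δ ⊆ S₀`. [folklore] -/
theorem exists_lift_of_totalDegree_le {σ : Type*} [Fintype σ] (S₀ : Subring L) [IsLocalRing S₀] {X : S₀}
    (hX : X ∈ maximalIdeal S₀) (hX0 : (X : L) ≠ 0) (y : σ → S₀) (hy : ∀ j, y j ∈ maximalIdeal S₀)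
    (Θ : blowupRing S₀ (X : L) →+* MvPolynomial σ (ResidueField S₀))
    (hΘC : ∀ s : S₀, Θ (Subring.inclusion (le_blowupRing S₀ (X : L)) s) = C (residue S₀ s))
    (hΘX : ∀ j, Θ ⟨((y j : S₀) : L) / (X : L), div_mem_blowupRing _ (hy j)⟩ = MvPolynomial.X j)
    (f : MvPolynomial σ (ResidueField S₀)) {δ : ℕ} (hf : f.totalDegree ≤ δ) :
    ∃ (w : blowupRing S₀ (X : L)) (G : S₀), Θ w = f ∧ G ∈ maximalIdeal S₀ ^ δ ∧
      (G : L) = (w : L) * (X : L) ^ δ := by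
  classical
  have hsurj : Function.Surjective (residue S₀) := Ideal.Quotient.mk_surjective
  choose c hc using hsurj
  let ι : S₀ →+* blowupRing S₀ (X : L) := Subring.inclusion (le_blowupRing S₀ (X : L))
  let t : σ → blowupRing S₀ (X : L) := fun j => ⟨((y j : S₀) : L) / (X : L), div_mem_blowupRing _ (hy j)⟩
  have hdeg : ∀ m ∈ f.support, ∑ j, m j ≤ δ := by
    intro m hm
    have h := MvPolynomial.le_totalDegree hm
    rw [Finsupp.sum_fintype _ _ (fun _ => rfl)] at h
    exact h.trans hf
  refine ⟨∑ m ∈ f.support, ι (c (f.coeff m)) * ∏ j, t j ^ (m j),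
    ∑ m ∈ f.support, c (f.coeff m) * ((∏ j, y j ^ (m j)) * X ^ (δ - ∑ j, m j)), ?_, ?_, ?_⟩
  · -- `Θ w = f`
    simp only [map_sum, map_mul, map_prod, map_pow, hΘC, hc, hΘX, ι, t]
    conv_rhs => rw [f.as_sum]
    refine Finset.sum_congr rfl fun m _ => ?_
    rw [MvPolynomial.monomial_eq, Finsupp.prod_pow]
  · -- `G ∈ 𝔪₀^δ`
    refine Ideal.sum_mem _ fun m hm => Ideal.mul_mem_left _ _ ?_
    have h1 : (∏ j, y j ^ (m j)) ∈ maximalIdeal S₀ ^ (∑ j, m j) := by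
      rw [← Finset.prod_pow_eq_pow_sum]
      exact Ideal.prod_mem_prod fun j _ => Ideal.pow_mem_pow (hy j) (m j)
    have h2 : X ^ (δ - ∑ j, m j) ∈ maximalIdeal S₀ ^ (δ - ∑ j, m j) := Ideal.pow_mem_pow hX _
    have h3 := Ideal.mul_mem_mul h1 h2
    rwa [← pow_add, Nat.add_sub_cancel' (hdeg m hm)] at h3
  · -- `G = w · X^δ` in `L`
    change S₀.subtype _ = (blowupRing S₀ (X : L)).subtype _ * (X : L) ^ δ
    simp only [map_sum, map_mul, map_prod, map_pow, Finset.sum_mul]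
    refine Finset.sum_congr rfl fun m hm => ?_
    have hXpow : (X : L) ^ δ = (X : L) ^ (∑ j, m j) * (X : L) ^ (δ - ∑ j, m j) := by
      rw [← pow_add, Nat.add_sub_cancel' (hdeg m hm)]
    change (c (f.coeff m) : L) * ((∏ j, ((y j : S₀) : L) ^ (m j)) * (X : L) ^ (δ - ∑ j, m j)) =
      (c (f.coeff m) : L) * (∏ j, (((y j : S₀) : L) / (X : L)) ^ (m j)) * (X : L) ^ δ
    rw [hXpow, mul_assoc]
    congr 1
    simp_rw [div_pow]
    rw [Finset.prod_div_distrib, Finset.prod_pow_eq_pow_sum, ← mul_assoc,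
      div_mul_cancel₀ _ (pow_ne_zero _ hX0)]

end Summit.ResolutionOfSingularities.ResolutionOfSingularities.Theorems.SwitchingDichotomy.ClaimR
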